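import Summits.BirchSwinnertonDyer.BirchSwinnertonDyer.Theorems.ManinLocalTwoThreeKummerCoverSubgroupTwo
import Summits.BirchSwinnertonDyer.BirchSwinnertonDyer.Theorems.ManinLocalTwoThreeSigmaSqRootKummerShimuraTwo
import Summits.BirchSwinnertonDyer.BirchSwinnertonDyer.Theorems.ManinLocalTwoThreeSquareRootDescent
import Summits.BirchSwinnertonDyer.Rank1Residual.ManinAdditive.EvenKummerShimuraNodes
import HarnessLib
import HarnessLib.Audit.Tags

/-!
# The all-even cuspidal Kummer class sits in the SHIMURA `2`-KERNEL: 6b-res on the locus `{∞,0}_f ∈ Λ₀(f)` is free, and on its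
# complement 6b-res IS E-an-152 ∧ E-an-152b (C2 line `ManinOddAtFour`, stmt-BirchSwinnertonDyer-22967; cell bsd-f2-manin, seat -an g42)

Answer to LEAD-MEMO v35 §4 -an asks (a) «E-an-152/152b/153 restricted to B» and (b) «is 6b‴ ⟺ "T ∉ ker(E₀ → E₁)" kernel-provable?
(then 6b‴|_A is free)».  Locus A = `modularSymbol D.f 0 ∈ periodLattice D.f` (⊇ root number `−1`), locus B = its complement (analytic rank 0).

ONE new node, everything else PROVED from it and the tree (no sorry):

* §1 **E-an-237 `EvenKummerRepCongruencePeriodic`** (`@[conjecture]`, THEOREM-CANDIDATE, prover-sized in three stubs): if the Kummer series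
  `Ξ_T` of a rational `2`-torsion point `T = (e, 0)` has a cuspidal Kummer representative `Ξ_T·B²·Xⁿ¹ = Xⁿ²·g·A²` (`IsCuspidalKummerRep`) whose
  η-exponent vector `r` is ALL EVEN, then for every half-period `p` of `T` (`p ∉ Λ_W`, `2p = m₁ω₁ + m₂ω₂`, `℘(p) = e + b₂/12`) the σ-square root
  `V_p = sigmaSqRoot Λ_W p (m₁η₁ + m₂η₂)` is periodic under `c·{∞,γ∞}_f` for every `γ ∈ Γ₀(N) ∩ Γ(8N)` — the CONGRUENCE hypothesis `hcong`
  (`M = 8N`) of p2's NC₂-glue `UDCTwo.sigmaSqRoot_gamma1_periodic_of_congruence`.  MECHANISM (why no UDC / CDT input is needed on the all-even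
  locus): with `s = r/2`, `√Ξ_T = ± q^{(n₂−n₁)/2}·ĝ_s·(A/B) = ± η_s(τ)·F(τ)`, `F ∈ ℚ(X₀(N))`; `η_s = ∏ η(δτ)^{s_δ}` satisfies `Σ s_δ = 0`,
  `12 ∣ Σ δ s_δ`, `12 ∣ Σ (N/δ) s_δ` (halves of `NewmanCond N r 0`) but NOT Newman's square condition, so by the η-multiplier system
  (`Literature…ModularCurveEtaQuotientsProofs`: `eta_SL2_smul`, `etaMultiplier_of_odd_d`, `newman_exponent_sum_dvd`, `newman_jacobi_prod_eq_one`
  minus its `hsq`) `η_s(γτ) = χ(γ)·η_s(τ)` on `Γ₀(N)` with `χ(γ) = ζ₂₄^{(…)·S₂ + b d·S₁}·(∏ δ^{|s_δ|} / |d|)`, and BOTH factors are `1` when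
  `γ ≡ 1 (mod 8N)` (`8 ∣ b, 8 ∣ c/N`, `12 ∣ S₁, S₂`; `d ≡ ±1 (mod 8N)` ⟹ `(2/|d|) = 1` and `(ℓ/|d|) = 1` for every odd prime `ℓ ∣ N` by
  reciprocity).  So `√Ξ_T` is a meromorphic function on `ℍ` invariant under `Γ₀(N) ∩ Γ(8N)`; p2's dictionary
  (`KummerSquareRootDictionary.exists_hasSum_const_mul_shortT_mul_sigmaSqRoot`: `√Ξ_T = κ·t_s·V_p(c·E_f)` near `i∞`, `κ ≠ 0`) and multiplier
  (`exists_sqMultiplier_gamma`, `forall_gamma_smul_eq_iff_sigmaSqRoot_periodic`) turn this into the periodicity of `V_p`.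
  STUBS for the prover: (α) `η_s` is `Γ₀(N) ∩ Γ(8N)`-invariant under the three congruences above [pure η-arithmetic, the tree lemmas + Mathlib
  `jacobiSym.quadratic_reciprocity` / `jacobiSym.at_two`]; (β) formal: all-even rep ⟹ `h := X^{(n₂−n₁)/2}·g_s·A/B ∈ ℚ⟦X⟧`, `h² = Ξ_T`, `h(0) = ±1`,
  `g = g_s²` for the `IsEtaUnitSeries` of `s` (`SquareRootDescent.etaLaurent_half_sq` shape); (γ) analytic continuation: `t_s·V_p(c·E_f)` is
  meromorphic on `ℍ` and equals `κ⁻¹·η_s·F` near `i∞`, hence `G₂(γτ₀) = G₂(τ₀)` at one point with `G₂(τ₀) ≠ 0`, which is all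
  `forall_gamma_smul_eq_iff_sigmaSqRoot_periodic`'s proof uses (`ρ_γ = 1`).  Stub (α) is TYPED here as the support node **S-an-g42-1
  `EtaQuotientInvariantOfHalfNewman`** (pure η-arithmetic over `etaQuotient`; M-sized); (γ) is, as of 22:08Z, essentially the LEAD's (DICT₂)
  `MinimalDictionaryTwo.kummerMinimalDictionaryTwo` (p747636) + p2's HOLB₂ (p747200) machinery.
* §2 PROVED — **6b-res IS FREE ON LOCUS A** (answer to (b), second half): `false_of_allEven_of_modularSymbol_zero_mem_of_print` — modulo E-an-237
  and the three PRINTED cusp facts F★ `optimalGamma1Parametrization_cusp_rational`, F♮ `optimalGamma1Parametrization_cuspZero_galoisConjugate`,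
  CES `exists_optimal_gamma1ParametrizationData`, on locus A NO rational `2`-torsion point (blind or not, ANY level `N`) has an all-even cuspidal
  Kummer representative (E-an-237 ⟹ `hcong` ⟹ p2 `UDCTwo.modularSymbol_zero_not_mem_of_congruence_of_print`); root-number-`−1` form
  `false_of_allEven_of_rootNumber_eq_neg_one_of_print`; hence the named restrictions **6b-res♮|_A `CuspidalKummerEvenExponentSquareAtCuspZero`**
  and 6b‴|_A hold (`…AtCuspZero_of_congruencePeriodic_of_print`).  No blindness row, no UDC, no CDT is consumed on locus A.
* §3 PROVED — **ON THE CORE, 6b-res♮ ⟸ E-an-237 ∧ E-an-152 ∧ E-an-152b** (answer to (b), first half, typed):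
  `cuspidalKummerEvenExponentSquare_of_congruencePeriodic_of_kernelRows` — E-an-237 ⟹ `hcong` ⟹ NC₂-glue ⟹ `Γ₁(N)`-periodicity of `V_p` ⟹
  LEAD's dichotomy `SigmaHabitat.periodLatticeGamma1_eq_kummerLineTwo_or_eq_two_mul` (`Λ₁ = ℤ·(2p/c) + 2Λ₀` or `Λ₁ = 2Λ₀`); the second is
  ¬E-an-152b; in the first, `w := 2p/c ∈ Λ₁(f) ∖ 2Λ₀(f)` and `Λ₁ ≠ Λ₀` (`periodLatticeGamma1_ne_of_sigmaSqRoot_gamma1_periodic`), so E-an-152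
  `ShimuraKernelBlindAtFour` produces a blind root `E` with `℘(c·w/2) = ℘(p) = E + a₂/3`, i.e. `E = e` — contradicting `¬ KummerBlindAtTwo a₂ a₄ e`.
  So «6b‴ ⟺ T ∉ ker(E₀ → E₁)» is kernel-provable in the direction C2 needs, GIVEN E-an-237: the all-even class forces `T` to generate the Shimura
  `2`-kernel (position), and the kernel generator is blind by E-an-152 (= `ord₂ c₀ = ord₂ c₁` on index `≡ 2 (mod 4)`, MEMO-an §76).  Corollaries by
  name: 6b-res `CuspidalKummerEvenExponentSquareOnCore`, 6b‴ `CuspidalKummerOddExponentOnCore` (p2 `SquareRootDescent…_of_isSquare_half`) and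
  E-an-53|₄ `CuspidalKummerOddExponent` from the same three rows.
* §4 TYPED + PROVED — the C2 v25 stub **6b-res|_B `CuspidalKummerEvenExponentSquareOnCoreB`** (VERBATIM type of `stub_cuspidalKummerEvenExponentSquareOnCoreB`),
  `6b-res|_B ⟺ 6b-res` modulo E-an-237 ∧ print, and the by-name target **`cuspidalKummerEvenExponentSquareOnCoreB_of_congruencePeriodic_of_B_of_print` :
  E-an-237 → F★ → F♮ → CES → E-an-152|_B → E-an-152b|_B → 6b-res|_B**.  **Ask (a): restricting E-an-152 / E-an-152b / E-an-153 to locus B costs nothing**: the B-forms `ShimuraKernelBlindAtFourB`,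
  `ShimuraIndexNeFourAtFourB`, `ShimuraTrivialOfNoBlindAtFourB` (extra binder `modularSymbol D₀.f 0 ∉ periodLattice D₀.f`) are EQUIVALENT to the
  originals modulo F★, F♮, CES (`…_of_B_of_print`, `…B_of_…`), because their own hypotheses (`Λ₁ ≠ Λ₀`, resp. index `4`) already put the class on B
  (LEAD `modularSymbol_zero_not_mem_of_ne_of_print`, `…_of_index_four_of_print`) and on A the conclusion of E-an-153 is LEAD's
  `periodLatticeGamma1_eq_of_modularSymbol_zero_mem_of_print`.  On B they are NOT free: they are the rows of MEMO-an §76 (blind ⟺ the Vélu model of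
  `E₀/⟨T⟩` is non-minimal at `2` ⟺ `c_ψ = 2` for the `2`-isogeny `ψ : E₀ → E₀/⟨T⟩`).
* §5 PROVED — the literal POSITION biconditional behind (b): `sigmaSqRoot_gamma1_periodic_iff_le_kummerLineTwo` — `V_p` is `Γ₁(N)`-periodic
  ⟺ `Λ₁(f) ⊆ ℤ·(2p/c) + 2Λ₀(f)` (⟹ LEAD `periodLatticeGamma1_le_kummerLineTwo`; ⟸ p2 `UDCTwo.sigmaSqRoot_periodic_of_mem_kummerTwo`), i.e.
  ⟺ `T_p ∈ ker(E₀ → E₁)` for lattice-optimal `D`.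

BC5 WITNESS (two engines, 4 ∣ N ≤ 2000): -data `KUMMER-4N2000-v1.tsv` (sha16 0b93399eaa2a726a; 1047 cuspidal candidate `2`-torsion roots) ×
-es `E15-LATTICE-INDEX-v1.tsv`: an ALL-EVEN exponent vector occurs for exactly 19/1047 roots; all 19 are BLIND (0/1016 non-blind roots are
all-even — 6b-res♮'s hypothesis is empty in range), all 19 classes have `[Λ₀(f):Λ₁(f)] = 2` and rank `0` (locus B, as §2 predicts), the 19 classes
ARE the 19 index-2 classes at `4 ∣ N ≤ 2000` (20a,24a,32a,40a,48a,52a,64a,80a,80b,116c,128b,128d,208c,212b,464e,692a,848d,916a,1172a), and the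
all-even root's quotient `E₀/⟨T⟩` is the Stevens curve `E₁` every time (24a4, 40a3, 48a4, 64a4, 80a2 in the five full-`2`-torsion classes) —
exactly the position E-an-237 ⟹ §5 predicts.  CHEAPEST FALSIFIER of E-an-237: one all-even cuspidal representative at a root whose class has
`Λ₁(f) = Λ₀(f)` (none ≤ 2000), or at a non-kernel root of an index-2 class (none ≤ 2000).

HONEST FRAMING.  E-an-237 is OPEN here (stubs α–γ are M-sized, no new idea); E-an-152, E-an-152b, 6b-res, 6b-res♮, 6b‴, C2 `ManinOddAtFour`, C3 and
Manin's conjecture remain OPEN; F★, F♮, CES are printed theorems not formalised here.  PARTITION 2 (kernel theorems modulo named rows) · beyond-print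
theorem: no · BSD is not proved by this.
[cite: Stevens1989, §2] [cite: Newman1959] [cite: Savitt2025, Thm. 1] [cite: ConradEdixhovenStein2003, Thm. 1.1.3] [folklore]
-/

set_option autoImplicit false

noncomputable section

open scoped PeriodPair MatrixGroups ModularForm NumberField
open Complex PowerSeries CongruenceSubgroup
open IsDedekindDomain IsDedekindDomain.HeightOneSpectrum Rat.HeightOneSpectrum
open WeierstrassCurve Literature.NumberTheory.EllipticCurves Literature.NumberTheory.EllipticCurves.ModularForms
open Summit.BirchSwinnertonDyer.Rank1Residual.ManinAdditive.CuspidalKummer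
open Summit.BirchSwinnertonDyer.Rank1Residual.ManinAdditive.ShimuraKernel
open Summit.BirchSwinnertonDyer.BirchSwinnertonDyer.Theorems.ManinLocalTwoThree.SigmaSquareRoot
open Summit.BirchSwinnertonDyer.BirchSwinnertonDyer.Theorems.ManinLocalTwoThree.SigmaHabitat
open Summit.BirchSwinnertonDyer.BirchSwinnertonDyer.Theorems.ManinLocalTwoThree.UDCTwo
open Summit.BirchSwinnertonDyer.BirchSwinnertonDyer.Theorems.ManinLocalTwoThree.SquareRootDescent

namespace Summit.BirchSwinnertonDyer.Rank1Residual.ManinAdditive.KummerShimuraTwo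

-- COMPANION (in the `Theses.ManinLocalTwoThree` cone) of the leaf `…ManinAdditive.EvenKummerShimuraNodes` (nodes E-an-237, S-an-g42-1, B-rows); all PROOFS live here.

/-! ## §1 The node E-an-237 -/

/-! ## §2 Locus A (`{∞,0}_f ∈ Λ₀(f)`, ⊇ root number `−1`): no all-even representative at all -/

section LocusA

variable {W : WeierstrassCurve ℚ} [W.IsElliptic] [W.IsGloballyMinimal] {N : ℕ} [NeZero N]

/-- **On locus A there is NO all-even cuspidal Kummer representative** (any rational `2`-torsion root, any level), modulo E-an-237 and F★, F♮, CES.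
[cite: Stevens1989, §2] [cite: ConradEdixhovenStein2003, Thm. 1.1.3] -/
theorem false_of_allEven_of_modularSymbol_zero_mem_of_print (h237 : EvenKummerRepCongruencePeriodic)
    (hF : optimalGamma1Parametrization_cusp_rational) (hFnat : optimalGamma1Parametrization_cuspZero_galoisConjugate)
    (hCES : exists_optimal_gamma1ParametrizationData)
    (D : ModularParametrizationData W N) (a : ℕ → ℤ) (ha : ∀ n, (a n : ℂ) = cuspCoeff D.f n)
    (hopt : ∀ z ∈ D.L.lattice, ∃ w ∈ periodLattice D.f, z = D.c * w)
    (h0 : modularSymbol D.f 0 ∈ periodLattice D.f)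
    {e : ℤ} (he : W.twoTorsionPolynomial.toPoly.IsRoot (e : ℚ)) {z : ℚ⟦X⟧} (hz : IsParamGerm W D.c a z)
    {r : ℕ → ℤ} {g A B : ℤ⟦X⟧} (hrep : IsCuspidalKummerRep N (kummerSeries W D.c ((e : ℚ)) z) r g A B)
    (hev : ∀ δ ∈ N.divisors, Even (r δ)) : False := by
  obtain ⟨p, hp, h2p, h℘⟩ := exists_halfPeriod_of_twoTorsion_root D he
  obtain ⟨m₁, m₂, hm⟩ := PeriodPair.mem_lattice.mp h2p
  have hN : 0 < 8 * N := Nat.mul_pos (by norm_num) (Nat.pos_of_ne_zero (NeZero.ne N))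
  exact modularSymbol_zero_not_mem_of_congruence_of_print hF hFnat hCES D hopt hp hm.symm hN
    (h237 W D a ha e he z hz r g A B hrep hev p m₁ m₂ hp hm.symm h℘) h0

/-- **Root number `−1` ⟹ no all-even cuspidal Kummer representative** (conductor level), modulo E-an-237 and F★, F♮, CES.
[cite: AtkinLehner1970, Thm. 3] [cite: Stevens1989, §2] -/
theorem false_of_allEven_of_rootNumber_eq_neg_one_of_print [NeZero (W.conductorNorm ℤ)] (h237 : EvenKummerRepCongruencePeriodic)
    (hF : optimalGamma1Parametrization_cusp_rational) (hFnat : optimalGamma1Parametrization_cuspZero_galoisConjugate)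
    (hCES : exists_optimal_gamma1ParametrizationData)
    (D : ModularParametrizationData W (W.conductorNorm ℤ)) (a : ℕ → ℤ) (ha : ∀ n, (a n : ℂ) = cuspCoeff D.f n)
    (hopt : ∀ z ∈ D.L.lattice, ∃ w ∈ periodLattice D.f, z = D.c * w) (hw : W.rootNumber = -1)
    {e : ℤ} (he : W.twoTorsionPolynomial.toPoly.IsRoot (e : ℚ)) {z : ℚ⟦X⟧} (hz : IsParamGerm W D.c a z)
    {r : ℕ → ℤ} {g A B : ℤ⟦X⟧} (hrep : IsCuspidalKummerRep (W.conductorNorm ℤ) (kummerSeries W D.c ((e : ℚ)) z) r g A B)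
    (hev : ∀ δ ∈ (W.conductorNorm ℤ).divisors, Even (r δ)) : False := by
  obtain ⟨p, hp, h2p, h℘⟩ := exists_halfPeriod_of_twoTorsion_root D he
  obtain ⟨m₁, m₂, hm⟩ := PeriodPair.mem_lattice.mp h2p
  have hN : 0 < 8 * W.conductorNorm ℤ := Nat.mul_pos (by norm_num) (Nat.pos_of_ne_zero (NeZero.ne _))
  have h1 := rootNumber_eq_one_of_congruence_of_print hF hFnat hCES D hopt hp hm.symm hN
    (h237 W D a ha e he z hz r g A B hrep hev p m₁ m₂ hp hm.symm h℘)
  rw [hw] at h1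
  norm_num at h1

end LocusA

/-- **6b-res♮|_A is FREE** modulo E-an-237 and the printed F★, F♮, CES (the all-even hypothesis is contradictory on locus A). -/
theorem cuspidalKummerEvenExponentSquareAtCuspZero_of_congruencePeriodic_of_print (h237 : EvenKummerRepCongruencePeriodic)
    (hF : optimalGamma1Parametrization_cusp_rational) (hFnat : optimalGamma1Parametrization_cuspZero_galoisConjugate)
    (hCES : exists_optimal_gamma1ParametrizationData) : CuspidalKummerEvenExponentSquareAtCuspZero := by
  intro W _ _ N _ D a ha _h4 hopt h0 a₂ a₄ e _ha1 _ha3 _ha2 _ha4 he _hnb z hz r g A B hrep hev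
  exact (false_of_allEven_of_modularSymbol_zero_mem_of_print h237 hF hFnat hCES D a ha hopt h0 he hz hrep hev).elim

/-! ## §3 On the core: 6b-res♮ ⟸ E-an-237 ∧ E-an-152 ∧ E-an-152b -/

/-- **6b-res♮ `CuspidalKummerEvenExponentSquare` ⟸ E-an-237 ∧ E-an-152 `ShimuraKernelBlindAtFour` ∧ E-an-152b `ShimuraIndexNeFourAtFour`.**
The all-even class puts `T` in the Shimura `2`-kernel (E-an-237 ⟹ NC₂-glue ⟹ LEAD's dichotomy); the kernel generator is blind (E-an-152), index `4`
is excluded (E-an-152b); so a NON-blind root has no all-even representative (the conclusion holds vacuously). [cite: Stevens1989, §2] -/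
theorem cuspidalKummerEvenExponentSquare_of_congruencePeriodic_of_kernelRows (h237 : EvenKummerRepCongruencePeriodic)
    (h152 : ShimuraKernelBlindAtFour) (h152b : ShimuraIndexNeFourAtFour) : CuspidalKummerEvenExponentSquare := by
  intro W _ _ N _ D a ha h4 hopt a₂ a₄ e ha1 ha3 ha2 ha4 he hnb z hz r g A B hrep hev
  exfalso
  obtain ⟨p, hp, h2p, h℘⟩ := exists_halfPeriod_of_twoTorsion_root D he
  obtain ⟨m₁, m₂, hm⟩ := PeriodPair.mem_lattice.mp h2p
  have hN : 0 < 8 * N := Nat.mul_pos (by norm_num) (Nat.pos_of_ne_zero (NeZero.ne N))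
  have hcong := h237 W D a ha e he z hz r g A B hrep hev p m₁ m₂ hp hm.symm h℘
  have hper := sigmaSqRoot_gamma1_periodic_of_congruence D hopt hp hm.symm hN hcong
  have h4' : 2 ^ 2 ∣ N := by norm_num; exact h4
  have hc : (D.c : ℂ) ≠ 0 := D.cast_c_ne_zero
  rcases periodLatticeGamma1_eq_kummerLineTwo_or_eq_two_mul D hopt h4' hp hm.symm hper with hA | hB
  · -- index `2`: `w := 2p/c ∈ Λ₁(f) ∖ 2Λ₀(f)`, `Λ₁ ≠ Λ₀`
    have hne := periodLatticeGamma1_ne_of_sigmaSqRoot_gamma1_periodic D hopt hp hm.symm hper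
    have hw : 2 * p / (D.c : ℂ) ∈ periodLatticeGamma1 D.f := (hA _).mpr ⟨1, 0, zero_mem _, by simp⟩
    have hnd : ∀ v ∈ periodLattice D.f, 2 * p / (D.c : ℂ) ≠ 2 * v := by
      intro v hv hEq
      apply hp
      have hpv : p = (D.c : ℂ) * v := by
        field_simp at hEq
        linear_combination hEq
      rw [hpv]
      exact D.smul_periodLattice_le v hv
    obtain ⟨A₂, A₄, E, hA₂, hA₄, -, h℘E, hblind⟩ := h152 W D hopt h4' ha1 ha3 hne _ hw hnd
    -- `℘(c·w/2) = ℘(p) = e + b₂/12 = e + a₂/3`, so `E = e`; and `A₂ = a₂`, `A₄ = a₄`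
    have hcw : (D.c : ℂ) * (2 * p / (D.c : ℂ)) / 2 = p := by field_simp
    rw [hcw, h℘] at h℘E
    have hb₂ : W.b₂ = 4 * W.a₂ := by rw [WeierstrassCurve.b₂, ha1]; ring
    rw [hb₂, ha2] at h℘E
    push_cast at h℘E
    have hEe : E = e := by
      have h1 : (E : ℂ) = (e : ℂ) := by linear_combination -h℘E
      exact_mod_cast h1
    have hA₂' : A₂ = a₂ := by
      have h1 : (A₂ : ℚ) = (a₂ : ℚ) := by rw [hA₂, ha2]
      exact_mod_cast h1
    have hA₄' : A₄ = a₄ := by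
      have h1 : (A₄ : ℚ) = (a₄ : ℚ) := by rw [hA₄, ha4]
      exact_mod_cast h1
    subst hEe hA₂' hA₄'
    exact hnb hblind
  · exact h152b W D hopt h4' hB

/-- Hence **6b-res `CuspidalKummerEvenExponentSquareOnCore` ⟸ E-an-237 ∧ E-an-152 ∧ E-an-152b** (C2 v23 stub 6b-res). -/
theorem cuspidalKummerEvenExponentSquareOnCore_of_congruencePeriodic_of_kernelRows (h237 : EvenKummerRepCongruencePeriodic)
    (h152 : ShimuraKernelBlindAtFour) (h152b : ShimuraIndexNeFourAtFour) : CuspidalKummerEvenExponentSquareOnCore :=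
  cuspidalKummerEvenExponentSquareOnCore_of_evenExponentSquare
    (cuspidalKummerEvenExponentSquare_of_congruencePeriodic_of_kernelRows h237 h152 h152b)

/-- Hence **6b‴ `CuspidalKummerOddExponentOnCore` ⟸ E-an-237 ∧ E-an-152 ∧ E-an-152b** (p2's square-root descent by name). -/
theorem cuspidalKummerOddExponentOnCore_of_congruencePeriodic_of_kernelRows (h237 : EvenKummerRepCongruencePeriodic)
    (h152 : ShimuraKernelBlindAtFour) (h152b : ShimuraIndexNeFourAtFour) : CuspidalKummerOddExponentOnCore :=
  cuspidalKummerOddExponentOnCore_of_isSquare_half fun W _ _ _N _ D a ha h16 hLat _ _ ↦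
    cuspidalKummerEvenExponentSquare_of_congruencePeriodic_of_kernelRows h237 h152 h152b W D a ha
      ((by norm_num : (4 : ℕ) ∣ 2 ^ 4).trans h16) hLat

/-- Hence **E-an-53|₄ `CuspidalKummerOddExponent` ⟸ E-an-237 ∧ E-an-152 ∧ E-an-152b** (p2's square-root descent by name). -/
theorem cuspidalKummerOddExponent_of_congruencePeriodic_of_kernelRows (h237 : EvenKummerRepCongruencePeriodic)
    (h152 : ShimuraKernelBlindAtFour) (h152b : ShimuraIndexNeFourAtFour) : CuspidalKummerOddExponent :=
  cuspidalKummerOddExponent_of_isSquare_half (cuspidalKummerEvenExponentSquare_of_congruencePeriodic_of_kernelRows h237 h152 h152b)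

/-! ## §4 Ask (a): the rows E-an-152 / E-an-152b / E-an-153 restricted to locus B (`{∞,0}_f ∉ Λ₀(f)`) -/

/-- **6b-res|_B ⟹ 6b-res** modulo E-an-237 and F★, F♮, CES (locus A is free, §2): the v25 restriction to B loses nothing. -/
theorem cuspidalKummerEvenExponentSquareOnCore_of_B_of_congruencePeriodic_of_print (h237 : EvenKummerRepCongruencePeriodic)
    (hF : optimalGamma1Parametrization_cusp_rational) (hFnat : optimalGamma1Parametrization_cuspZero_galoisConjugate)
    (hCES : exists_optimal_gamma1ParametrizationData) (h : CuspidalKummerEvenExponentSquareOnCoreB) :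
    CuspidalKummerEvenExponentSquareOnCore := by
  intro W _ _ N _ D a ha h16 hLat hj hcore a₂ a₄ e ha1 ha3 ha2 ha4 he hnb z hz r g A B hrep hev
  by_cases h0 : modularSymbol D.f 0 ∈ periodLattice D.f
  · exact (false_of_allEven_of_modularSymbol_zero_mem_of_print h237 hF hFnat hCES D a ha hLat h0 he hz hrep hev).elim
  · exact h W D a ha h16 hLat hj hcore h0 a₂ a₄ e ha1 ha3 ha2 ha4 he hnb z hz r g A B hrep hev

section LocusB

/-- **E-an-152|_B ⟹ E-an-152** modulo F★, F♮, CES: the hypothesis `Λ₁ ≠ Λ₀` already puts the class on locus B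
(LEAD `modularSymbol_zero_not_mem_of_ne_of_print`). -/
theorem shimuraKernelBlindAtFour_of_B_of_print (hF : optimalGamma1Parametrization_cusp_rational)
    (hFnat : optimalGamma1Parametrization_cuspZero_galoisConjugate) (hCES : exists_optimal_gamma1ParametrizationData)
    (h : ShimuraKernelBlindAtFourB) : ShimuraKernelBlindAtFour :=
  fun W₀ _ _ _N _ D₀ hopt h4 ha1 ha3 hne ↦
    h W₀ D₀ hopt h4 (modularSymbol_zero_not_mem_of_ne_of_print hF hFnat hCES D₀ hopt hne) ha1 ha3 hne

/-- **E-an-152b|_B ⟹ E-an-152b** modulo F★, F♮, CES: index `4` already puts the class on locus B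
(LEAD `modularSymbol_zero_not_mem_of_index_four_of_print`). -/
theorem shimuraIndexNeFourAtFour_of_B_of_print (hF : optimalGamma1Parametrization_cusp_rational)
    (hFnat : optimalGamma1Parametrization_cuspZero_galoisConjugate) (hCES : exists_optimal_gamma1ParametrizationData)
    (h : ShimuraIndexNeFourAtFourB) : ShimuraIndexNeFourAtFour :=
  fun W₀ _ _ _N _ D₀ hopt h4 hidx ↦
    h W₀ D₀ hopt h4 (modularSymbol_zero_not_mem_of_index_four_of_print hF hFnat hCES D₀ hopt hidx) hidx

/-- **E-an-153|_B ⟹ E-an-153** modulo F★, F♮, CES: on locus A the conclusion `Λ₁ = Λ₀` is LEAD's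
`periodLatticeGamma1_eq_of_modularSymbol_zero_mem_of_print`. -/
theorem shimuraTrivialOfNoBlindAtFour_of_B_of_print (hF : optimalGamma1Parametrization_cusp_rational)
    (hFnat : optimalGamma1Parametrization_cuspZero_galoisConjugate) (hCES : exists_optimal_gamma1ParametrizationData)
    (h : ShimuraTrivialOfNoBlindAtFourB) : ShimuraTrivialOfNoBlindAtFour := by
  intro W₀ _ _ N _ D₀ hopt h4 ha1 ha3 hnb
  by_cases h0 : modularSymbol D₀.f 0 ∈ periodLattice D₀.f
  · exact periodLatticeGamma1_eq_of_modularSymbol_zero_mem_of_print hF hFnat hCES D₀ hopt h0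
  · exact h W₀ D₀ hopt h4 h0 ha1 ha3 hnb

/-- So the C2 v23 stub 6b-res is, modulo E-an-237 and print, the two B-rows: **6b-res ⟸ E-an-237 ∧ E-an-152|_B ∧ E-an-152b|_B ∧ F★ ∧ F♮ ∧ CES**. -/
theorem cuspidalKummerEvenExponentSquareOnCore_of_congruencePeriodic_of_B_of_print (h237 : EvenKummerRepCongruencePeriodic)
    (hF : optimalGamma1Parametrization_cusp_rational) (hFnat : optimalGamma1Parametrization_cuspZero_galoisConjugate)
    (hCES : exists_optimal_gamma1ParametrizationData) (h152 : ShimuraKernelBlindAtFourB) (h152b : ShimuraIndexNeFourAtFourB) :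
    CuspidalKummerEvenExponentSquareOnCore :=
  cuspidalKummerEvenExponentSquareOnCore_of_congruencePeriodic_of_kernelRows h237
    (shimuraKernelBlindAtFour_of_B_of_print hF hFnat hCES h152) (shimuraIndexNeFourAtFour_of_B_of_print hF hFnat hCES h152b)

/-- **THE C2 v25 STUB 6b-res|_B ⟸ E-an-237 ∧ E-an-152|_B ∧ E-an-152b|_B ∧ F★ ∧ F♮ ∧ CES** (by-name target for `stub_cuspidalKummerEvenExponentSquareOnCoreB`). -/
theorem cuspidalKummerEvenExponentSquareOnCoreB_of_congruencePeriodic_of_B_of_print (h237 : EvenKummerRepCongruencePeriodic)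
    (hF : optimalGamma1Parametrization_cusp_rational) (hFnat : optimalGamma1Parametrization_cuspZero_galoisConjugate)
    (hCES : exists_optimal_gamma1ParametrizationData) (h152 : ShimuraKernelBlindAtFourB) (h152b : ShimuraIndexNeFourAtFourB) :
    CuspidalKummerEvenExponentSquareOnCoreB :=
  cuspidalKummerEvenExponentSquareOnCoreB_of
    (cuspidalKummerEvenExponentSquareOnCore_of_congruencePeriodic_of_B_of_print h237 hF hFnat hCES h152 h152b)

end LocusB

/-! ## §5 The position biconditional: `V_p` is `Γ₁(N)`-periodic ⟺ `Λ₁(f) ⊆ ℤ·(2p/c) + 2Λ₀(f)` (`T_p ∈ ker(E₀ → E₁)`) -/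

section Position

variable {W : WeierstrassCurve ℚ} [W.IsElliptic] [W.IsGloballyMinimal] {N : ℕ} [NeZero N]

omit [W.IsElliptic] [W.IsGloballyMinimal] in
/-- **POSITION ⟺ PERIODICITY** (lattice-optimal `D`, half-period `p`): the σ-square root `V_p` is periodic under `c·Λ₁(f)` iff
`Λ₁(f) ⊆ ℤ·(2p/c) + 2Λ₀(f)`, i.e. iff the `2`-torsion point `T_p` lies in the kernel of `E₀ → E₁` (`E₁` = Stevens' curve `ℂ/c·Λ₁(f)`).
(⟹ LEAD `periodLatticeGamma1_le_kummerLineTwo`; ⟸ p2 `sigmaSqRoot_periodic_of_mem_kummerTwo`.) [cite: Stevens1989, §2] -/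
theorem sigmaSqRoot_gamma1_periodic_iff_le_kummerLineTwo (D : ModularParametrizationData W N)
    (hopt : ∀ z ∈ D.L.lattice, ∃ w ∈ periodLattice D.f, z = D.c * w) {p : ℂ} {m₁ m₂ : ℤ} (hp : p ∉ D.L.lattice)
    (h2p : 2 * p = m₁ * D.L.ω₁ + m₂ * D.L.ω₂) :
    (∀ γ : Gamma1 N, ∀ w : ℂ,
      sigmaSqRoot D.L p (m₁ * D.L.η₁ + m₂ * D.L.η₂) (w + (D.c : ℂ) * cuspSymbol D.f ⟨(γ : SL(2, ℤ)), Gamma1_in_Gamma0 N γ.2⟩) =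
        sigmaSqRoot D.L p (m₁ * D.L.η₁ + m₂ * D.L.η₂) w) ↔
      ∀ z ∈ periodLatticeGamma1 D.f, ∃ k : ℤ, ∃ v ∈ periodLattice D.f, z = k * (2 * p / D.c) + 2 * v := by
  refine ⟨periodLatticeGamma1_le_kummerLineTwo D hopt hp h2p, fun hline γ w ↦ ?_⟩
  have hc : (D.c : ℂ) ≠ 0 := D.cast_c_ne_zero
  obtain ⟨k, v, hv, hEq⟩ := hline _ (cuspSymbol_mem_periodLatticeGamma1 D.f γ)
  refine sigmaSqRoot_periodic_of_mem_kummerTwo D.L h2p ⟨k, (D.c : ℂ) * v, D.smul_periodLattice_le v hv, ?_⟩ w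
  rw [hEq, mul_add, show (D.c : ℂ) * (k * (2 * p / D.c)) = k * (2 * p) by field_simp]
  ring

/-- Hence, with E-an-237: **an all-even representative puts `T` in the Shimura `2`-kernel** — `Λ₁(f) ⊆ ℤ·(2p/c) + 2Λ₀(f)` for every half-period
`p` of `T` (lattice-optimal `D`, any level). -/
theorem le_kummerLineTwo_of_allEven (h237 : EvenKummerRepCongruencePeriodic)
    (D : ModularParametrizationData W N) (a : ℕ → ℤ) (ha : ∀ n, (a n : ℂ) = cuspCoeff D.f n)
    (hopt : ∀ z ∈ D.L.lattice, ∃ w ∈ periodLattice D.f, z = D.c * w)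
    {e : ℤ} (he : W.twoTorsionPolynomial.toPoly.IsRoot (e : ℚ)) {z : ℚ⟦X⟧} (hz : IsParamGerm W D.c a z)
    {r : ℕ → ℤ} {g A B : ℤ⟦X⟧} (hrep : IsCuspidalKummerRep N (kummerSeries W D.c ((e : ℚ)) z) r g A B)
    (hev : ∀ δ ∈ N.divisors, Even (r δ)) {p : ℂ} {m₁ m₂ : ℤ} (hp : p ∉ D.L.lattice)
    (h2p : 2 * p = m₁ * D.L.ω₁ + m₂ * D.L.ω₂) (h℘ : ℘[D.L] p = ((e : ℚ) : ℂ) + (W.b₂ : ℂ) / 12) :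
    ∀ x ∈ periodLatticeGamma1 D.f, ∃ k : ℤ, ∃ v ∈ periodLattice D.f, x = k * (2 * p / D.c) + 2 * v := by
  have hN : 0 < 8 * N := Nat.mul_pos (by norm_num) (Nat.pos_of_ne_zero (NeZero.ne N))
  exact (sigmaSqRoot_gamma1_periodic_iff_le_kummerLineTwo D hopt hp h2p).mp
    (sigmaSqRoot_gamma1_periodic_of_congruence D hopt hp h2p hN
      (h237 W D a ha e he z hz r g A B hrep hev p m₁ m₂ hp h2p h℘))

end Position

end Summit.BirchSwinnertonDyer.Rank1Residual.ManinAdditive.KummerShimuraTwo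

end
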